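import Literature.NumberTheory.EllipticCurves.ZpExtensionScalarTwistResidualProofs
import Literature.NumberTheory.EllipticCurves.ZpExtensionEisensteinTwistFreeProofs
import Literature.NumberTheory.GaloisCohomology.Howard2004.SelmerTriples
import HarnessLib

/-!
# The residual presentation `T_𝔮/𝔪T_𝔮 = E[p]` of Howard's Eisenstein twist as an object of `Quot(T_𝔮)`:
# the residue character `A_{m,k} → 𝔽_p` (definition), `𝔪_{A_{m,k}} = ([T])`, and `IsQuotientBy … 𝔪 …`

Topic `NumberTheory/EllipticCurves`; companion of `ZpExtensionScalarTwistResidualProofs` (the residual reduction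
`A_{m,k} ⊗ M ↠ N` as an additive map with its kernel and equivariance), now in the currency of the tree's typing of
Howard 2004 §1 (`Literature.NumberTheory.GaloisCohomology.Howard2004`, file `Howard2004/SelmerTriples.lean`):
`IsQuotientBy ρ I ρI π` («`N` presents `T/IT`»: `π : T →ₗ[R] N` surjective, kernel `I·T`, equivariant) and the
hypothesis `H1 ρ ρbar πbar` whose first clause is `IsQuotientBy ρ (maximalIdeal R) ρbar πbar`.

* `EisensteinCoeff.residueChar p hm hk : A_{m,k} →+* ZMod p` — **DEFINITION WITH BODY** (`Ideal.Quotient.lift` of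
  `Λ → ℤ_p → ℤ/p`, `[F] ↦ F(0) mod p`; `m, k ≥ 1`), with `residueChar_mk`, `residueChar_onePlusT`, `residueChar_mk_X`,
  `residueChar_surjective`, `ker_residueChar : ker = ([T])`;
* `isLocalRing_eisensteinCoeff` (via the tree's `nontrivial_eisensteinCoeff`), **`maximalIdeal_eisensteinCoeff_eq : 𝔪 = ([T])`**;
* `EisensteinCoeff.residueModule p hm hk hN : Module A_{m,k} N` — **DEFINITION** (reducible, NOT an instance): the
  `A_{m,k}`-module structure on a group `N` killed by `p` through the residue character (for `N = E[p]`); `residueModule_smul`;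
* **`exists_isQuotientBy_eisensteinTwist`** — for any `A_{m,k}`-module structure on `N` factoring through the residue character
  (`c • n = (ε c).val • n`) and a reduction datum `r : M ↠ N` (kernel `pM`, equivariant), there is an `A_{m,k}`-LINEAR
  `π : A_{m,k} ⊗ M → N`, `π (1 ⊗ a) = r a`, with `Howard2004.IsQuotientBy (κ.eisensteinTwist ρ hm k) ([T]) ρN π`; and
  `exists_isQuotientBy_maximalIdeal_eisensteinTwist` — the same with `I = maximalIdeal A_{m,k}`, i.e. the first clause of `H1`
  for the specialised module at level `k` with `T̄ = N` (`= E[p]`).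
No named fact, no instance, no `sorry`. Howard's sentence being formalised: «`T̄_𝔭 ≅ E[p] ⊗ S_𝔭/𝔪` … the action of `G_K`
on `S_𝔭/𝔪` factors through `G_K → Λ/(p, γ−1) → S_𝔭/𝔪`, and so is trivial on the second factor» (proof of Prop. 2.1.3).

Cell `pub/bsd-print-x9`, seat `bsd-line-x9-p1-w2` (g5), v9-plan STUB 1a (H.1/H.2/H.5 for `t_m`) of the shared μ-item
on crux stmt-BirchSwinnertonDyer-27077.

References: [Howard2004HeegnerKolyvagin] §1.1 Def. 1.1.3, §1.3 H.1/H.5, proof of Prop. 2.1.3 (arXiv 2.1.3 / 3.1.3);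
[Washington1997] §7.1 (Λ/(p, T) = 𝔽_p).
-/

noncomputable section

open scoped TensorProduct

namespace Literature.NumberTheory.EllipticCurves

namespace IwasawaAlgebra.EisensteinCoeff

variable (p : ℕ) [hp : Fact p.Prime]

/-! ## §1 The residue character and the maximal ideal of `A_{m,k}` -/

/-- The composite `Λ → ℤ_p → ℤ/p` kills `(T^m + p, p^k)` for `m, k ≥ 1`. [cite: Washington1997, §7.1 (Λ/(p,T) = 𝔽_p)] -/
theorem span_qm_sup_span_C_pow_le_ker {m k : ℕ} (hm : 1 ≤ m) (hk : 1 ≤ k) :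
    (Ideal.span {(PowerSeries.X ^ m + PowerSeries.C (p : ℤ_[p]) : IwasawaAlgebra p)} ⊔
        Ideal.span {PowerSeries.C ((p : ℤ_[p]) ^ k)}) ≤
      RingHom.ker ((PadicInt.toZMod (p := p)).comp (PowerSeries.constantCoeff (R := ℤ_[p]))) := by
  have hfp : (PadicInt.toZMod (p := p)).comp PowerSeries.constantCoeff (PowerSeries.C (p : ℤ_[p])) = 0 := by
    rw [RingHom.comp_apply, PowerSeries.constantCoeff_C, map_natCast, ZMod.natCast_self]
  refine sup_le ?_ ?_
  · rw [Ideal.span_le, Set.singleton_subset_iff, SetLike.mem_coe, RingHom.mem_ker, map_add, map_pow, hfp,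
      RingHom.comp_apply, PowerSeries.constantCoeff_X, map_zero, zero_pow (by omega), zero_add]
  · rw [Ideal.span_le, Set.singleton_subset_iff, SetLike.mem_coe, RingHom.mem_ker,
      map_pow (PowerSeries.C (R := ℤ_[p])), map_pow, hfp, zero_pow (by omega)]

/-- **The residue character `ε : A_{m,k} → 𝔽_p = ℤ/p`, `[F] ↦ F(0) mod p`** (`m, k ≥ 1`): the reduction of
`A_{m,k} = Λ/(T^m + p, p^k)` modulo its maximal ideal `([T]) = (π)` — Howard's «`G_K → Λ/(p, γ − 1) → S_𝔭/𝔪`» at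
the finite level. A definition with body (`Ideal.Quotient.lift`). [cite: Howard2004HeegnerKolyvagin, proof of Prop. 2.1.3 (arXiv 3.1.3)]
[cite: Washington1997, §7.1] -/
def residueChar {m k : ℕ} (hm : 1 ≤ m) (hk : 1 ≤ k) : EisensteinCoeff p m k →+* ZMod p :=
  Ideal.Quotient.lift _ ((PadicInt.toZMod (p := p)).comp (PowerSeries.constantCoeff (R := ℤ_[p])))
    fun _ ha ↦ span_qm_sup_span_C_pow_le_ker p hm hk ha

/-- `ε [F] = F(0) mod p`. [cite: Howard2004HeegnerKolyvagin, proof of Prop. 2.1.3] -/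
@[simp]
theorem residueChar_mk {m k : ℕ} (hm : 1 ≤ m) (hk : 1 ≤ k) (F : IwasawaAlgebra p) :
    residueChar p hm hk (Ideal.Quotient.mk _ F) = PadicInt.toZMod (PowerSeries.constantCoeff F) :=
  Ideal.Quotient.lift_mk _ _ _

/-- `ε [T] = 0`. [cite: Howard2004HeegnerKolyvagin, proof of Prop. 2.1.3] -/
theorem residueChar_mk_X {m k : ℕ} (hm : 1 ≤ m) (hk : 1 ≤ k) :
    residueChar p hm hk (Ideal.Quotient.mk _ PowerSeries.X) = 0 := by
  rw [residueChar_mk, PowerSeries.constantCoeff_X, map_zero]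

/-- `ε (1 + T) = 1`: the character `ψ` is residually trivial. [cite: Howard2004HeegnerKolyvagin, proof of Prop. 2.1.3] -/
theorem residueChar_onePlusT {m k : ℕ} (hm : 1 ≤ m) (hk : 1 ≤ k) :
    residueChar p hm hk (onePlusT p m k) = 1 := by
  rw [onePlusT_def, map_add, map_one, map_add, map_one, residueChar_mk_X, add_zero]

/-- `ε` on natural-number classes: `ε n = n`. [cite: Washington1997, §7.1] -/
theorem residueChar_natCast {m k : ℕ} (hm : 1 ≤ m) (hk : 1 ≤ k) (n : ℕ) :
    residueChar p hm hk (n : EisensteinCoeff p m k) = n :=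
  map_natCast _ n

/-- `ε` is surjective. [cite: Washington1997, §7.1] -/
theorem residueChar_surjective {m k : ℕ} (hm : 1 ≤ m) (hk : 1 ≤ k) :
    Function.Surjective (residueChar p hm hk) := fun x ↦
  ⟨(x.val : EisensteinCoeff p m k), by rw [residueChar_natCast, ZMod.natCast_zmod_val]⟩

/-- **`ker ε = ([T])`**: a class `[F]` with `F(0) ∈ pℤ_p` is `[T·G] + [p]·[b] ∈ ([T])` (`[p] = −[T]^m`).
[cite: Howard2004HeegnerKolyvagin, proof of Prop. 2.1.3] [cite: Washington1997, §7.1] -/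
theorem ker_residueChar {m k : ℕ} (hm : 1 ≤ m) (hk : 1 ≤ k) :
    RingHom.ker (residueChar p hm hk) =
      Ideal.span {(Ideal.Quotient.mk _ PowerSeries.X : EisensteinCoeff p m k)} := by
  set I : Ideal (IwasawaAlgebra p) :=
    Ideal.span {(PowerSeries.X ^ m + PowerSeries.C (p : ℤ_[p]) : IwasawaAlgebra p)} ⊔
      Ideal.span {PowerSeries.C ((p : ℤ_[p]) ^ k)} with hI
  have h1 : Ideal.Quotient.mk I (PowerSeries.C (p : ℤ_[p])) = (p : IwasawaAlgebra p ⧸ I) := by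
    rw [map_natCast, map_natCast]
  apply le_antisymm
  · intro a ha
    obtain ⟨F, rfl⟩ := Ideal.Quotient.mk_surjective a
    rw [RingHom.mem_ker, residueChar_mk] at ha
    have hdvd : (p : ℤ_[p]) ∣ PowerSeries.constantCoeff F := by
      have hker : PowerSeries.constantCoeff F ∈ RingHom.ker (PadicInt.toZMod (p := p)) := ha
      rw [PadicInt.ker_toZMod, PadicInt.maximalIdeal_eq_span_p, Ideal.mem_span_singleton] at hker
      exact hker
    obtain ⟨b, hb⟩ := hdvd
    obtain ⟨G, hG⟩ : PowerSeries.X ∣ F - PowerSeries.C (PowerSeries.constantCoeff F) := by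
      rw [PowerSeries.X_dvd_iff, map_sub, PowerSeries.constantCoeff_C, sub_self]
    have hF : F = PowerSeries.X * G + PowerSeries.C (p : ℤ_[p]) * PowerSeries.C b := by
      rw [← map_mul, ← hb]; linear_combination hG
    rw [hF, map_add, map_mul, map_mul, h1]
    exact Ideal.add_mem _ (Ideal.mul_mem_right _ _ (Ideal.mem_span_singleton_self _))
      (Ideal.mul_mem_right _ _ (natCast_mem_span_mk_X p hm k))
  · rw [Ideal.span_le, Set.singleton_subset_iff, SetLike.mem_coe, RingHom.mem_ker]
    exact residueChar_mk_X p hm hk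

/-- `A_{m,k}` is a local ring for `m, k ≥ 1` (a non-trivial quotient of the local ring `Λ`).
[cite: Howard2004HeegnerKolyvagin, Rem. 1.1.4 (R principal and Artinian)] [cite: Washington1997, §7.1] -/
theorem isLocalRing_eisensteinCoeff {m k : ℕ} (hm : 1 ≤ m) (hk : 1 ≤ k) : IsLocalRing (EisensteinCoeff p m k) := by
  haveI := nontrivial_eisensteinCoeff (p := p) hm hk
  exact IsLocalRing.of_surjective' (Ideal.Quotient.mk _) Ideal.Quotient.mk_surjective

/-- **The maximal ideal of `A_{m,k}` is `([T])`** (`m, k ≥ 1`): `([T])` is the kernel of the surjection onto the field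
`ℤ/p`, hence maximal, hence THE maximal ideal of the local ring `A_{m,k}` (Howard's `𝔪 = πR`).
[cite: Howard2004HeegnerKolyvagin, Rem. 1.1.4 and proof of Prop. 2.1.3] [cite: Washington1997, §7.1] -/
theorem maximalIdeal_eisensteinCoeff_eq {m k : ℕ} (hm : 1 ≤ m) (hk : 1 ≤ k) :
    @IsLocalRing.maximalIdeal _ _ (isLocalRing_eisensteinCoeff p hm hk) =
      Ideal.span {(Ideal.Quotient.mk _ PowerSeries.X : EisensteinCoeff p m k)} := by
  letI := isLocalRing_eisensteinCoeff p hm hk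
  rw [← ker_residueChar p hm hk]
  exact (IsLocalRing.eq_maximalIdeal (RingHom.ker_isMaximal_of_surjective _ (residueChar_surjective p hm hk))).symm

/-! ## §2 The residual `A_{m,k}`-module structure on a group killed by `p` -/

variable {p} in
/-- **The `A_{m,k}`-module structure on a `p`-torsion group `N` through the residue character** (`N = E[p]`:
`[F] • P = F(0) · P`). A reducible definition, NOT an instance (use with `letI`). [cite: Howard2004HeegnerKolyvagin, proof of Prop. 2.1.3 (E[p] ⊗ S_𝔭/𝔪)] -/
abbrev residueModule {m k : ℕ} (hm : 1 ≤ m) (hk : 1 ≤ k) {N : Type*} [AddCommGroup N]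
    (hN : ∀ n : N, p • n = 0) : Module (EisensteinCoeff p m k) N :=
  letI : Module (ZMod p) N := AddCommGroup.zmodModule hN
  Module.compHom N (residueChar p hm hk)

/-- Under `residueModule`: `c • n = (ε c).val • n`. [cite: Howard2004HeegnerKolyvagin, proof of Prop. 2.1.3] -/
theorem residueModule_smul {m k : ℕ} (hm : 1 ≤ m) (hk : 1 ≤ k) {N : Type*} [AddCommGroup N]
    (hN : ∀ n : N, p • n = 0) (c : EisensteinCoeff p m k) (n : N) :
    (letI := residueModule hm hk hN; c • n) = (residueChar p hm hk c).val • n := by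
  letI : Module (ZMod p) N := AddCommGroup.zmodModule hN
  change (residueChar p hm hk c) • n = _
  conv_lhs => rw [← ZMod.natCast_zmod_val (residueChar p hm hk c)]
  exact Nat.cast_smul_eq_nsmul _ _ _

end IwasawaAlgebra.EisensteinCoeff

/-! ## §3 The residual presentation as an object of `Quot(T_𝔮/p^k)` -/

namespace ZpExtension

open Literature.NumberTheory.GaloisRepresentations Field

variable {K : Type} [Field K] {p : ℕ} [hp : Fact p.Prime] (κ : ZpExtension K p)
  {M : Type} [AddCommGroup M] [TopologicalSpace M] [DiscreteTopology M]
  (ρ : DiscreteGaloisModule K M) {m : ℕ} (hm : 1 ≤ m) {k : ℕ} (hk : 1 ≤ k)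

/-- **`T_𝔮/p^k ↠ T̄ = N` is a presentation of the quotient by `([T])` in Howard's category `Quot(T)`.** For an
`A_{m,k}`-module `N` on which `A_{m,k}` acts through the residue character (`c • n = (ε c).val • n`; e.g.
`residueModule`), a discrete `Γ_K`-structure `ρN` on `N`, and a reduction datum `r : M ↠ N` (kernel `pM`,
intertwining `ρ` and `ρN`), there is an `A_{m,k}`-LINEAR `π : A_{m,k} ⊗ M → N` with `π (1 ⊗ a) = r a` and
`Howard2004.IsQuotientBy (κ.eisensteinTwist ρ hm k) ([T]) ρN π` — surjective, kernel `([T])·(A ⊗ M)`, equivariant from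
the TWISTED action to the untwisted `ρN`. [cite: Howard2004HeegnerKolyvagin, Def. 1.1.3 and proof of Prop. 2.1.3 (T̄_𝔭 ≅ E[p] ⊗ S_𝔭/𝔪)] -/
theorem exists_isQuotientBy_eisensteinTwist {N : Type} [AddCommGroup N] [TopologicalSpace N] [DiscreteTopology N]
    [Module (IwasawaAlgebra.EisensteinCoeff p m k) N]
    (hsmulN : ∀ (c : IwasawaAlgebra.EisensteinCoeff p m k) (n : N),
      c • n = (IwasawaAlgebra.EisensteinCoeff.residueChar p hm hk c).val • n)
    (ρN : DiscreteGaloisModule K N) (r : M →+ N) (hr : Function.Surjective r)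
    (hrker : ∀ a : M, r a = 0 ↔ ∃ b : M, a = p • b)
    (hrρ : ∀ (σ : absoluteGaloisGroup K) (a : M), r (ρ σ a) = ρN σ (r a)) :
    ∃ π : IwasawaAlgebra.EisensteinCoeff.Twisted p m k M →ₗ[IwasawaAlgebra.EisensteinCoeff p m k] N,
      (∀ a : M, π (IwasawaAlgebra.EisensteinCoeff.Twisted.tmul 1 a) = r a) ∧
      GaloisCohomology.Howard2004.IsQuotientBy (κ.eisensteinTwist ρ hm k)
        (Ideal.span {(Ideal.Quotient.mk _ PowerSeries.X : IwasawaAlgebra.EisensteinCoeff p m k)}) ρN π := by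
  haveI : Fact (1 < p) := ⟨hp.out.one_lt⟩
  -- `p` kills `N`
  have hN : ∀ n : N, p • n = 0 := fun n ↦ by
    rw [← Nat.cast_smul_eq_nsmul (IwasawaAlgebra.EisensteinCoeff p m k), hsmulN,
      IwasawaAlgebra.EisensteinCoeff.residueChar_natCast, ZMod.natCast_self, ZMod.val_zero, zero_smul]
  have hmod : ∀ (n : ℕ) (v : N), (n % p) • v = n • v := fun n v ↦ by
    conv_rhs => rw [← Nat.mod_add_div n p, add_nsmul, mul_comm, mul_nsmul, hN, add_zero]
  obtain ⟨red, hred1, hredF, hsurj, hker, hequiv⟩ :=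
    κ.exists_residualReduction ρ hm k hk ρN r hr hrker hrρ hN
  -- `red (c ⊗ a) = (ε c).val • r a`
  have hredc : ∀ (c : IwasawaAlgebra.EisensteinCoeff p m k) (a : M),
      red (IwasawaAlgebra.EisensteinCoeff.Twisted.tmul c a) =
        (IwasawaAlgebra.EisensteinCoeff.residueChar p hm hk c).val • r a := fun c a ↦ by
    obtain ⟨F, rfl⟩ := Ideal.Quotient.mk_surjective c
    rw [hredF, IwasawaAlgebra.EisensteinCoeff.residueChar_mk]
  -- `red` is `A_{m,k}`-linear for the residual module structure on `N`
  have hlin : ∀ (c : IwasawaAlgebra.EisensteinCoeff p m k) (x : IwasawaAlgebra.EisensteinCoeff.Twisted p m k M),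
      red (c • x) = c • red x := fun c x ↦ by
    induction x using IwasawaAlgebra.EisensteinCoeff.Twisted.induction_on with
    | zero => rw [smul_zero, map_zero, smul_zero]
    | tmul c' a =>
      rw [IwasawaAlgebra.EisensteinCoeff.Twisted.smul_tmul, hredc, hredc, hsmulN, map_mul, ZMod.val_mul, hmod,
        mul_smul]
    | add x y hx hy => rw [smul_add, map_add, map_add, hx, hy, smul_add]
  let π : IwasawaAlgebra.EisensteinCoeff.Twisted p m k M →ₗ[IwasawaAlgebra.EisensteinCoeff p m k] N :=
    { toFun := red, map_add' := red.map_add, map_smul' := hlin }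
  refine ⟨π, hred1, ⟨hsurj, ?_, hequiv⟩⟩
  ext x
  rw [LinearMap.mem_ker, ← Submodule.mem_toAddSubgroup, ← hker, AddMonoidHom.mem_ker]
  rfl

/-- **The same presentation for `I = 𝔪_{A_{m,k}}`** — the first clause `IsQuotientBy ρ (maximalIdeal R) ρbar πbar` of
Howard's H.1 (`Howard2004.H1`) for the specialised module `T_𝔮/p^k` with `T̄ = N` (`= E[p]`), the local-ring structure on
`A_{m,k}` being `isLocalRing_eisensteinCoeff`. [cite: Howard2004HeegnerKolyvagin, H.1 (arXiv p. 7, L59) and proof of Prop. 2.1.3] -/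
theorem exists_isQuotientBy_maximalIdeal_eisensteinTwist {N : Type} [AddCommGroup N] [TopologicalSpace N]
    [DiscreteTopology N] [Module (IwasawaAlgebra.EisensteinCoeff p m k) N]
    (hsmulN : ∀ (c : IwasawaAlgebra.EisensteinCoeff p m k) (n : N),
      c • n = (IwasawaAlgebra.EisensteinCoeff.residueChar p hm hk c).val • n)
    (ρN : DiscreteGaloisModule K N) (r : M →+ N) (hr : Function.Surjective r)
    (hrker : ∀ a : M, r a = 0 ↔ ∃ b : M, a = p • b)
    (hrρ : ∀ (σ : absoluteGaloisGroup K) (a : M), r (ρ σ a) = ρN σ (r a)) :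
    ∃ π : IwasawaAlgebra.EisensteinCoeff.Twisted p m k M →ₗ[IwasawaAlgebra.EisensteinCoeff p m k] N,
      (∀ a : M, π (IwasawaAlgebra.EisensteinCoeff.Twisted.tmul 1 a) = r a) ∧
      GaloisCohomology.Howard2004.IsQuotientBy (κ.eisensteinTwist ρ hm k)
        (@IsLocalRing.maximalIdeal _ _ (IwasawaAlgebra.EisensteinCoeff.isLocalRing_eisensteinCoeff p hm hk)) ρN π := by
  rw [IwasawaAlgebra.EisensteinCoeff.maximalIdeal_eisensteinCoeff_eq p hm hk]
  exact κ.exists_isQuotientBy_eisensteinTwist ρ hm hk hsmulN ρN r hr hrker hrρ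

end ZpExtension

end Literature.NumberTheory.EllipticCurves

end
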